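import Literature.NumberTheory.EllipticCurves.DegreeConjectureAbc
import Literature.NumberTheory.DiophantineGeometry.AbcSixteenReduction
import HarnessLib

/-!
# The modular degree conjecture for semistable curves implies abc

Topic `Literature/NumberTheory/EllipticCurves` (family `abc`). Theorems only. The variant of
`Literature.NumberTheory.EllipticCurves.abcLe_of_freyDegreeBound` (Frey; Mai–Murty; Murty 1999,
Thm. 1) whose hypothesis is the degree conjecture in the SEMISTABLE, GLOBAL-MINIMAL-MODEL form of
routes `ABC/QuaternionicDegree` (`SemistableDegreeConjecture`, `∀ D, deg ≤ C c² N^{2+ε}`) and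
`ABC/IsogenyGlueCongruence` (`SemistableDegreeConjecture`, `∃ D, deg ≤ C N^{2+ε}`):

> for every `ε > 0` there is `C` such that every semistable elliptic curve over `ℚ`, given by a
> global minimal equation `W`, admits at level `N = N_E` a modular parametrisation datum with
> `deg ≤ C · c² · N^{2+ε}` (`c` its Manin constant).

* `covolume_ge_of_deg_le` — the Frey–Murty covolume bound for an arbitrary datum (Zagier, proved,
  + degree bound + Petersson bound).
* `abcLe_sixteen_of_semistableDegreeBound` — the hypothesis, with the named facts
  `murty_petersson_newform_lower_bound` and `silverman1986_discriminant_c4_covolume`, gives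
  `c ≤ C_ε rad(abc)^{1+ε}` for the abc triples with `16 ∣ abc`: these are exactly the triples whose
  Frey–Hellegouarch curve has, after Serre's normalisation (`exists_arrangement`), the semistable
  global minimal equation (12.18) `freyIntModel₂ A B` (Bombieri–Gubler Ex. 12.5.10:
  `isMinimalAt_freyIntModel₂`, `isSemistableAt_freyIntModel₂`, `conductorNorm_freyIntModel₂_dvd`).
* `abcLe_of_semistableDegreeBound` — hence for all abc triples, by the elementary reduction
  `Literature.NumberTheory.DiophantineGeometry.abcLe_of_abcLe_sixteen_dvd`
  (auxiliary triple `(u⁸, v⁸ − u⁸, v⁸)`).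

## References

* M. R. Murty, *Bounds for congruence primes*, Proc. Sympos. Pure Math. 66.1 (1999), Thm. 1
  (statement as reported by Pasten, Rem. 3.3). [MurtyCongruencePrimes1999]
* H. Pasten, *Shimura curves and the abc conjecture*, arXiv:1705.09251 = JNT 254 (2024), §3.
  [PastenShimura2024]
* G. Frey, in: Modular Forms and Fermat's Last Theorem (1997), §3, Cor. 3.1. [Frey1997Ternary]
* E. Bombieri, W. Gubler, *Heights in Diophantine Geometry* (2006), Ex. 12.5.10.
  [BombieriGubler2006]
-/

noncomputable section

open IsDedekindDomain WeierstrassCurve NumberField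

namespace Literature.NumberTheory.EllipticCurves

open ModularForms CongruenceSubgroup UniqueFactorizationMonoid

variable {W : WeierstrassCurve ℚ} {N : ℕ} [NeZero N] in
/-- **Frey–Murty covolume bound, general datum.** For any modular parametrisation datum `D` of any
`W/ℚ` at level `N`: Zagier's `4π² c² (f,f) = deg · covol(Λ)` (`zagier_degree_formula_holds`),
`deg ≤ C₁ c² N^{2+δ}` and `c₂ N^{1−δ} ≤ (f,f)` give `covol(Λ) ≥ (4π² c₂/C₁) N^{−(1+2δ)}`
(Pasten arXiv:1705.09251 §3, (3.2) and the remark after it). [cite: PastenShimura2024, §3 (3.2)] -/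
theorem covolume_ge_of_deg_le (D : ModularParametrizationData W N) {C₁ c₂ δ : ℝ} (hC₁ : 0 < C₁)
    (hdeg : (D.deg : ℝ) ≤ C₁ * (D.c : ℝ) ^ 2 * (N : ℝ) ^ (2 + δ))
    (hP : c₂ * (N : ℝ) ^ (1 - δ) ≤ (peterssonProduct (Gamma0 N) 2 D.f D.f).re) :
    4 * Real.pi ^ 2 * c₂ / C₁ * (N : ℝ) ^ (-(1 + 2 * δ)) ≤ ZLattice.covolume D.L.lattice := by
  have hN : (0 : ℝ) < N := by exact_mod_cast Nat.pos_of_ne_zero (NeZero.ne N)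
  have hc0 : D.maninConstant ≠ 0 := D.maninConstant_ne_zero_holds
  have hc : (D.c : ℝ) ≠ 0 := by exact_mod_cast hc0
  have hcov : 0 < ZLattice.covolume D.L.lattice := ZLattice.covolume_pos _ _
  have hZ := congrArg Complex.re D.zagier_degree_formula_holds
  rw [Complex.re_ofReal_mul, Complex.ofReal_re] at hZ
  exact covolume_ge_of_zagier hN hC₁ hc hcov hZ hdeg hP

/-- **Semistable degree conjecture ⟹ abc for the triples with `16 ∣ abc`.** Assume the Petersson
lower bound (`murty_petersson_newform_lower_bound`), Silverman's covolume inequality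
(`silverman1986_discriminant_c4_covolume`) and: for every `ε > 0` there is `C` such that every
semistable elliptic `W/ℚ` in global minimal form admits at level `N_E` a parametrisation datum
with `deg ≤ C c² N_E^{2+ε}`. Then `c ≤ C_ε rad(abc)^{1+ε}` for all abc triples with `16 ∣ abc`
(through the semistable minimal equation (12.18) of the normalised Frey curve; Murty 1999 Thm. 1,
Frey 1997 Cor. 3.1, Pasten §3). [cite: MurtyCongruencePrimes1999, Thm. 1 (degree conjecture implies abc) via PastenShimura2024 §3 Rem. 3.3] -/
theorem abcLe_sixteen_of_semistableDegreeBound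
    (hP : murty_petersson_newform_lower_bound)
    (hS : silverman1986_discriminant_c4_covolume)
    (hdeg : ∀ ε : ℝ, 0 < ε → ∃ C : ℝ, ∀ (W : WeierstrassCurve ℚ) [W.IsElliptic]
      [W.IsGloballyMinimal] [NeZero (W.conductorNorm ℤ)], W.IsSemistable ℤ →
        ∃ D : ModularParametrizationData W (W.conductorNorm ℤ),
          (D.deg : ℝ) ≤ C * (D.c : ℝ) ^ 2 * ((W.conductorNorm ℤ : ℕ) : ℝ) ^ (2 + ε)) :
    ∀ ε : ℝ, 0 < ε → ∃ C : ℝ, ∀ a b c : ℕ, DiophantineGeometry.IsABCTriple a b c →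
      16 ∣ a * b * c → (c : ℝ) ≤ C * ((DiophantineGeometry.rad a b c : ℕ) : ℝ) ^ (1 + ε) := by
  intro ε hε
  set δ : ℝ := min 1 (ε / 3) with hδdef
  have hδ : 0 < δ := lt_min one_pos (by positivity)
  have hδ1 : δ ≤ 1 := min_le_left _ _
  have hδε : 3 * δ ≤ ε := by have := min_le_right 1 (ε / 3); linarith
  obtain ⟨C₀, hC₀⟩ := hdeg δ hδ
  obtain ⟨c₂, hc₂, hPc⟩ := hP δ hδ
  obtain ⟨A₀, hA₀⟩ := hS δ hδ
  have hA : (0 : ℝ) ≤ max A₀ 1 := zero_le_one.trans (le_max_right _ _)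
  have hC₁ : (0 : ℝ) < max C₀ 1 := one_pos.trans_le (le_max_right _ _)
  set κ : ℝ := 4 * Real.pi ^ 2 * c₂ / max C₀ 1 with hκdef
  have hκ : 0 < κ := div_pos (by positivity) hC₁
  set M : ℝ := 8 * max A₀ 1 * κ ^ (-(6 + δ)) * (2 ^ 10) ^ ((1 + 2 * δ) * (6 + δ)) with hMdef
  have hM : 0 ≤ M := by positivity
  refine ⟨M ^ (1 / 6 : ℝ), fun a b c h h16 ↦ ?_⟩
  have h' := h
  obtain ⟨ha, hb, habc, hcop⟩ := h'
  have hc0 : 0 < c := by omega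
  have habc0 : a * b * c ≠ 0 := by positivity
  set R : ℝ := ((DiophantineGeometry.rad a b c : ℕ) : ℝ) with hRdef
  have hRpos : 0 < DiophantineGeometry.rad a b c := by
    rw [DiophantineGeometry.rad_def]; exact Nat.pos_of_ne_zero radical_ne_zero
  have hR : (1 : ℝ) ≤ R := by rw [hRdef]; exact_mod_cast hRpos
  -- Serre's normalisation and the semistable global minimal equation (12.18)
  obtain ⟨A, B, hAB, hA4, hB, hprod, hquad⟩ := exists_arrangement h h16
  have h0 : A * B * (A + B) ≠ 0 := by
    rw [← Int.natAbs_ne_zero, hprod]; exact habc0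
  have h4 : 4 ∣ B - A - 1 := by
    have : B - A - 1 = B - (A + 1) := by ring
    rw [this]; exact dvd_sub (dvd_trans (by norm_num) hB) hA4
  have h16' : 16 ∣ A * B := dvd_mul_of_dvd_right hB _
  set W : WeierstrassCurve ℚ := (freyIntModel₂ A B).baseChange ℚ with hWdef
  haveI : W.IsElliptic := isElliptic_freyIntModel₂ h0 h4 h16'
  haveI : W.IsGloballyMinimal :=
    isGloballyMinimal_of_forall_isMinimalAt_int _ (isMinimalAt_freyIntModel₂ hAB hA4 hB)
  have hN0 : 0 < W.conductorNorm ℤ := conductorNorm_pos_holds W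
  haveI : NeZero (W.conductorNorm ℤ) := ⟨hN0.ne'⟩
  have hss : W.IsSemistable ℤ := fun v ↦ isSemistableAt_freyIntModel₂ hAB h0 hA4 hB v
  obtain ⟨D, hD⟩ := hC₀ W hss
  set Nn : ℕ := W.conductorNorm ℤ with hNn
  -- the covolume bound
  have hxy : 0 ≤ (D.c : ℝ) ^ 2 * (Nn : ℝ) ^ (2 + δ) := by positivity
  have hD' : (D.deg : ℝ) ≤ max C₀ 1 * (D.c : ℝ) ^ 2 * (Nn : ℝ) ^ (2 + δ) := by
    calc (D.deg : ℝ) ≤ C₀ * (D.c : ℝ) ^ 2 * (Nn : ℝ) ^ (2 + δ) := hD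
      _ = C₀ * ((D.c : ℝ) ^ 2 * (Nn : ℝ) ^ (2 + δ)) := by ring
      _ ≤ max C₀ 1 * ((D.c : ℝ) ^ 2 * (Nn : ℝ) ^ (2 + δ)) :=
          mul_le_mul_of_nonneg_right (le_max_left _ _) hxy
      _ = _ := by ring
  have hPD := hPc Nn W D.f D.isNewformOf
  have hlow := covolume_ge_of_deg_le D hC₁ hD' hPD
  -- Silverman for the Néron lattice `D.L` of the minimal model `W`
  have hSW := hA₀ W D.L D.isNeronLattice
  have hcov : 0 < ZLattice.covolume D.L.lattice := ZLattice.covolume_pos _ _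
  have hc₄W : W.c₄ = ((freyIntModel₂ A B).c₄ : ℚ) := by
    simp [hWdef, WeierstrassCurve.baseChange, WeierstrassCurve.map_c₄]
  have hc₄ : |((freyIntModel₂ A B).c₄ : ℝ)| ^ 3 ≤
      max A₀ 1 * ZLattice.covolume D.L.lattice ^ (-(6 + δ)) := by
    have h1 : ((|W.c₄| ^ 3 : ℚ) : ℝ) ≤ ((max |W.Δ| (|W.c₄| ^ 3) : ℚ) : ℝ) := by
      exact_mod_cast le_max_right _ _
    have e1 : |((freyIntModel₂ A B).c₄ : ℝ)| ^ 3 = ((|W.c₄| ^ 3 : ℚ) : ℝ) := by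
      rw [hc₄W]; norm_cast
    rw [e1]
    exact (h1.trans hSW).trans (mul_le_mul_of_nonneg_right (le_max_left A₀ 1)
      (Real.rpow_nonneg hcov.le _))
  -- `N ∣ rad(abc)` and `c² ≤ 2 c₄'`
  have hdvd : Nn ∣ DiophantineGeometry.rad a b c := by
    rw [hNn, hWdef, DiophantineGeometry.rad_def, ← hprod]
    exact conductorNorm_freyIntModel₂_dvd hAB h0 hA4 hB
  have hNle : ((Nn : ℕ) : ℝ) ≤ 2 ^ 10 * R := by
    have h1 : ((Nn : ℕ) : ℝ) ≤ R := by rw [hRdef]; exact_mod_cast Nat.le_of_dvd hRpos hdvd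
    exact h1.trans (le_mul_of_one_le_left (zero_le_one.trans hR) (by norm_num))
  have hNpos : (0 : ℝ) < ((Nn : ℕ) : ℝ) := by exact_mod_cast hN0
  have hcc4 : (c : ℝ) ^ 2 ≤ 2 * |((freyIntModel₂ A B).c₄ : ℝ)| := by
    rw [freyIntModel₂_c₄ h4 h16']
    have hq : (0 : ℤ) ≤ A ^ 2 + A * B + B ^ 2 := by
      nlinarith [sq_nonneg (A + B), sq_nonneg A, sq_nonneg B]
    have hz : ((c : ℕ) : ℤ) ^ 2 ≤ 2 * |A ^ 2 + A * B + B ^ 2| := by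
      rw [abs_of_nonneg hq, hquad]; nlinarith [sq_nonneg (a : ℤ), sq_nonneg (b : ℤ)]
    have hzr : (((c : ℕ) : ℤ) : ℝ) ^ 2 ≤ 2 * |((A ^ 2 + A * B + B ^ 2 : ℤ) : ℝ)| := by
      exact_mod_cast hz
    simpa using hzr
  -- bookkeeping (`covol' = covol`)
  have h6 := pow_six_le_of_estimates hδ hA hκ hNpos hcov hcc4 hc₄ le_rfl hlow hNle hR
  exact le_of_pow_six_le (Nat.cast_nonneg c) hM hR (exponent_le hδ hδ1 hδε) h6

/-- **The modular degree conjecture for semistable curves implies the abc conjecture** (Frey;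
Mai–Murty; Murty 1999 Thm. 1, ⟸), relative to the named facts
`murty_petersson_newform_lower_bound` and `silverman1986_discriminant_c4_covolume`: the
hypothesis of `abcLe_sixteen_of_semistableDegreeBound` gives the `≤`-form of the strong
abc-conjecture for all abc triples (reduction to `16 ∣ abc` by
`DiophantineGeometry.abcLe_of_abcLe_sixteen_dvd`). Serves the assemblies of routes
`ABC/QuaternionicDegree` and `ABC/IsogenyGlueCongruence`. [cite: MurtyCongruencePrimes1999, Thm. 1 (degree conjecture implies abc) via PastenShimura2024 §3 Rem. 3.3] -/
theorem abcLe_of_semistableDegreeBound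
    (hP : murty_petersson_newform_lower_bound)
    (hS : silverman1986_discriminant_c4_covolume)
    (hdeg : ∀ ε : ℝ, 0 < ε → ∃ C : ℝ, ∀ (W : WeierstrassCurve ℚ) [W.IsElliptic]
      [W.IsGloballyMinimal] [NeZero (W.conductorNorm ℤ)], W.IsSemistable ℤ →
        ∃ D : ModularParametrizationData W (W.conductorNorm ℤ),
          (D.deg : ℝ) ≤ C * (D.c : ℝ) ^ 2 * ((W.conductorNorm ℤ : ℕ) : ℝ) ^ (2 + ε)) :
    ∀ ε : ℝ, 0 < ε → ∃ C : ℝ, ∀ a b c : ℕ, DiophantineGeometry.IsABCTriple a b c →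
      (c : ℝ) ≤ C * ((DiophantineGeometry.rad a b c : ℕ) : ℝ) ^ (1 + ε) :=
  DiophantineGeometry.abcLe_of_abcLe_sixteen_dvd (abcLe_sixteen_of_semistableDegreeBound hP hS hdeg)

end Literature.NumberTheory.EllipticCurves

end
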